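import Mathlib
import Summits.QuantumFields.YangMills.Theses.GronwallGap
import Summits.QuantumFields.YangMills.Theses.DirichletWindow
import Summits.QuantumFields.YangMills.Theses.ScalingWindowSplit
import Summits.QuantumFields.YangMills.Theorems.ScalingWindowSplitExistenceLegFromLatticeR
import Summits.QuantumFields.YangMills.Theorems.ScalingWindowSplitEuclideanUpgrade
import Summits.QuantumFields.YangMills.Theorems.GronwallGapContinuumFromLatticeGapDockSWSGlue
import Summits.QuantumFields.YangMills.Theorems.ComplexCouplingChannelContinuumLegGivenGapSplit
import Summits.QuantumFields.YangMills.Theorems.ConvexGribovBodyContinuumLegGivenGapCsclScheme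
import Summits.QuantumFields.YangMills.Theorems.GronwallGapContinuumFromLatticeGapStubLockOffE
import Summits.QuantumFields.YangMills.Theorems.GronwallGapContinuumFromLatticeGapStubCriticalOfLock
import Summits.QuantumFields.YangMills.Theorems.GronwallGapContinuumFromLatticeGapStubRpSpectralOfColdPressure
import HarnessLib

/-!
# `ContinuumFromLatticeGap` (stmt-QuantumFields-15915), line `registered`, reshape 3: the dock on `ScalingWindowSplit`

Support file for the crux item stmt-QuantumFields-15915
(`Summit.QuantumFields.YangMills.Theses.GronwallGap.ContinuumFromLatticeGap`).  The DEF-FREE rendering of the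
reshape-4 skeleton `Cruxes/ContinuumFromLatticeGap/Lines/birth.lean`: the crux — and its sibling stmt-QuantumFields-15828
`ContinuumLegGivenGap` — follow from

* `DirichletWindow.XiDiverges` (stmt-QuantumFields-8941, by name),
* the two registered open IR stubs of the line (reshape 4), INLINED as hypotheses: ONE SCALE at the lock
  (`stub_oneScale`: pinned unit, polynomial volumes, a past-supported bump with the polynomial floor and the window of
  the bare truncated curvature two-point function) and COLD PRESSURE at the lock (`stub_coldPressureAtLock`: the
  trace-excess bound of the cold tori along every lock-pinned scheme), the latter turned into W₁'s RP-spectral clause by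
  the landed `stub_rpSpectralOfColdPressure`,
* the FILED cruxes of route `ScalingWindowSplit`: U_R `SelfNormalisedMomentBoundsR` (stmt-QuantumFields-18014), W₂
  `SelfNormalisedSkewness` (stmt-QuantumFields-18944), and `CoincidenceRotationBootstrap.CurvatureAmnesia`
  (stmt-QuantumFields-16192), all by name.

Chain: the landed lock (`stub_lockOffE` for 15915 / `cclgSplit_locked_of_core` for 15828) and criticality from the lock
alone (`stub_criticalOfLock`, which serves both) give the locked critical datum; one scale pins the unit and supplies
volumes, bump, floor ∧ window; the `SpeciesScheme` record on `(a, β ∘ φ, L)` is weak-coupling with polynomial volumes and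
carries `HasLatticeMassGap` (`cclgSplit_gap_of_locked`) at the RP-spectral rate; U_R and W₂ fed this scheme give the
self-normalised moment bounds and the `κ₃` floor; the landed seam `ScalingWindowSplit.oneField_of_latticeInequalities`
gives the one-field clauses along a weak-coupling scheme; `hypercubicAt_of_oneField` and `concl_of_hypercubicAt`
(orientation amnesia by name, density upgrade proved) give the Clay `G`-clause.

Also: `stub_bareScheme` (registered anchor of the line: the bare scheme record on given data).
No definitions, no notation, no named facts.  References: Glimm–Jaffe (1987) §6.1, §19.1; Osterwalder–Seiler (1978) §2.
-/

noncomputable section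

namespace Summit.QuantumFields.YangMills.Theorems.ContinuumFromLatticeGap

open scoped SchwartzMap
open Filter Topology MeasureTheory
open Literature.MathematicalPhysics.QuantumFieldTheory Literature.MathematicalPhysics.QuantumLattice
  Literature.MathematicalPhysics.AQFT Literature.Probability.LatticeModels
open Summit.QuantumFields.YangMills.Theses
open Summit.QuantumFields.YangMills.Theorems.ContinuumLegGivenGap
open Summit.QuantumFields.YangMills.Cruxes.HypercubicLimit.CouplingResponse (OneFieldClauses)

/-- **`stub_bareScheme`** (registered anchor of line `registered`, reshape 3; a step of its composition): the BARE
`SpeciesScheme` record (`c ≡ 1`, `m ≡ 0`) on given spacings `a_k > 0`, `a_k → 0`, couplings `b_k` and volumes `L_k`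
with `a_k L_k → ∞`. [folklore] -/
theorem stub_bareScheme : ∀ (G : Type) [Group G] [MeasurableSpace G] (a b : ℕ → ℝ) (L : ℕ → ℕ),
    (∀ k, 0 < a k) → Tendsto a atTop (𝓝 0) → Tendsto (fun k => a k * (L k : ℝ)) atTop atTop →
    ∃ sch : SpeciesScheme (YMSpecies G), (∀ k, sch.a k = a k) ∧ (∀ k, sch.β k = b k) ∧ (∀ k, sch.L k = L k) ∧
      (∀ s k, sch.c s k = 1) ∧ (∀ s k, sch.m s k = 0) :=
  fun _ _ _ a b L ha ha0 hL =>
    ⟨{ a := a, a_pos := ha, tendsto_a := ha0, β := b, L := L, tendsto_L := hL, c := fun _ _ => 1, m := fun _ _ => 0 },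
      fun _ => rfl, fun _ => rfl, fun _ => rfl, fun _ _ => rfl, fun _ _ => rfl⟩

section Core

variable {G : Type} [Group G] [TopologicalSpace G] [IsTopologicalGroup G] [CompactSpace G]

/-- **The Clay `G`-clause from a locked critical datum, one scale, the RP-spectral clause and the filed items** (the
common core of the two compositions below).  At a compact simple `G` (Borel σ-algebra) and a faithful `r`: a locked
datum (`β_k → ∞`, rates `m̂_k`, UNIFORM with thresholds `S₁`) with `m̂ → 0`; one-scale data at it (unit `Δ₀ a_k ≤ m̂(φ k)`,
volumes `L_k ≥ S₁(φ k)` of polynomial growth, a past-supported bump `u` with floor ∧ window for every scheme on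
`(a, β ∘ φ, L)`); the RP-spectral clause for every scheme pinned to the lock; U_R, W₂ and orientation amnesia by name.
Then the Clay `G`-clause. [cite: GlimmJaffe1987, §6.1 and §19.1] -/
theorem concl_of_lockedDatum (hG : IsCompactSimpleLieGroup G)
    (hU : ScalingWindowSplit.SelfNormalisedMomentBoundsR) (hW₂ : ScalingWindowSplit.SelfNormalisedSkewness)
    (hA : CoincidenceRotationBootstrap.CurvatureAmnesia)
    (r : letI : MeasurableSpace G := borel G; LatticeRep G) (β mh : ℕ → ℝ) (S₁ : ℕ → ℕ)
    (hβ : Tendsto β atTop atTop)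
    (hUNIF : letI : MeasurableSpace G := borel G; haveI : BorelSpace G := ⟨rfl⟩;
      ∀ A B : YMSpecies G, ∃ C : ℝ, ∀ k S n : ℕ, S₁ k ≤ S → n ≤ S →
        |latticeConnectedCorr r.ρ (β k) (2 * S + 1) A.F B.F n| ≤ C * Real.exp (-(mh k * n)))
    (hcrit : Tendsto mh atTop (𝓝 0))
    (a : ℕ → ℝ) (φ : ℕ → ℕ) (Δ₀ : ℝ) (L : ℕ → ℕ) (u : 𝓢(EuclideanSpace ℝ (Fin 4), ℝ)) (p : ℕ) (M : ℝ)
    (ha : ∀ k, 0 < a k) (hφ : StrictMono φ) (hΔ₀ : 0 < Δ₀) (hpin : ∀ k, Δ₀ * a k ≤ mh (φ k))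
    (hLS : ∀ k, S₁ (φ k) ≤ L k) (hpoly : ∃ N : ℕ, 1 ≤ N ∧ ∀ᶠ k in atTop, (a k)⁻¹ ≤ (a k * (L k : ℝ)) ^ N)
    (hu : tsupport u ⊆ {y : EuclideanSpace ℝ (Fin 4) | y 0 < 0})
    (hfw : letI : MeasurableSpace G := borel G; haveI : BorelSpace G := ⟨rfl⟩;
      ∀ sch : SpeciesScheme (YMSpecies G), (∀ k, sch.a k = a k) → (∀ k, sch.β k = β (φ k)) →
        (∀ k, sch.L k = L k) →
        let bare : SpeciesScheme (YMSpecies G) := { sch with c := fun _ _ => 1, m := fun _ _ => 0 }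
        let T : 𝓢(EuclideanSpace ℝ (Fin 4), ℝ) → ℕ → ℝ := fun w k =>
          latticeSchwinger r.ρ bare (fun s => s.F) k (1 + 1) (fun _ => r.curvature) ![w, thetaTest 4 w] -
            latticeSchwinger r.ρ bare (fun s => s.F) k 1 (fun _ => r.curvature) ![w] *
              latticeSchwinger r.ρ bare (fun s => s.F) k 1 (fun _ => r.curvature) ![thetaTest 4 w]
        ∀ᶠ k in atTop, (sch.a k) ^ p ≤ T u k ∧ T u k ≤ M * T (timeShiftTest 4 (-1) u) k)
    (hRP : letI : MeasurableSpace G := borel G; haveI : BorelSpace G := ⟨rfl⟩;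
      ∀ (sch : SpeciesScheme (YMSpecies G)) (φ : ℕ → ℕ) (Δ₀ : ℝ), StrictMono φ → 0 < Δ₀ →
        (∀ k, sch.β k = β (φ k)) → (∀ k, Δ₀ * sch.a k ≤ mh (φ k)) → (∀ k, S₁ (φ k) ≤ sch.L k) →
        (∃ N : ℕ, 1 ≤ N ∧ ∀ᶠ k in atTop, (sch.a k)⁻¹ ≤ (sch.a k * (sch.L k : ℝ)) ^ N) →
        ∃ Δ C : ℝ, 0 < Δ ∧ Δ ≤ Δ₀ ∧
          ∀ᶠ k in atTop, ∀ (S₀ T₀ n : ℕ), sch.L k ≤ S₀ → 2 * (T₀ + n + 1) ≤ S₀ →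
            ∀ (Y : LGConfig 4 G → ℝ) (B : ℝ), Measurable Y → (∀ U, |Y U| ≤ B) →
              DependsOn Y {e : Literature.MathematicalPhysics.QuantumLattice.ZdEdge 4 |
                1 ≤ e.1 0 ∧ e.1 0 + (if e.2 = 0 then 1 else 0) ≤ T₀} →
              |(∫ U, Y (torusLift (2 * S₀ + 1) (GaugeConfig.timeReflect U)) *
                    Y (configShift (-Pi.single 0 (n : ℤ)) (torusLift (2 * S₀ + 1) U))
                  ∂(wilsonMeasure r.ρ (sch.β k) : Measure (GaugeConfig 4 (2 * S₀ + 1) G))) -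
                (∫ U, Y (torusLift (2 * S₀ + 1) U)
                  ∂(wilsonMeasure r.ρ (sch.β k) : Measure (GaugeConfig 4 (2 * S₀ + 1) G))) ^ 2| ≤
                Real.exp (-(Δ * sch.a k * n)) *
                  ((∫ U, Y (torusLift (2 * S₀ + 1) (GaugeConfig.timeReflect U)) * Y (torusLift (2 * S₀ + 1) U)
                      ∂(wilsonMeasure r.ρ (sch.β k) : Measure (GaugeConfig 4 (2 * S₀ + 1) G))) -
                    (∫ U, Y (torusLift (2 * S₀ + 1) U)
                      ∂(wilsonMeasure r.ρ (sch.β k) : Measure (GaugeConfig 4 (2 * S₀ + 1) G))) ^ 2) +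
                C * B ^ 2 * Real.exp (-(Δ * sch.a k * S₀))) :
    letI : MeasurableSpace G := borel G
    haveI : BorelSpace G := ⟨rfl⟩
    ∃ (r : LatticeRep G) (sch : SpeciesScheme (YMSpecies G)) (T : OSData (YMSpecies G) 4),
      sch.HasWeakCouplingLimit ∧ IsYangMillsFor r sch T ∧ T.IsNontrivial r.curvature ∧
        T.IsNonGaussian r.curvature ∧ ∃ Δ > 0, T.HasMassGap Δ ∧ HasLatticeMassGap r sch Δ := by
  letI : MeasurableSpace G := borel G
  haveI : BorelSpace G := ⟨rfl⟩
  obtain ⟨N, hN1, hpolyN⟩ := hpoly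
  -- the scheme on the locked data
  have ha0 : Tendsto a atTop (𝓝 0) := stub_unitToZero a mh φ Δ₀ ha hφ hΔ₀ hpin hcrit
  have hLt : Tendsto (fun k => a k * (L k : ℝ)) atTop atTop := cscl_tendsto_mul_of_pow hN1 ha ha0 hpolyN
  obtain ⟨sch, hsa, hsβ, hsL, -, -⟩ := stub_bareScheme G a (fun k => β (φ k)) L ha ha0 hLt
  have hw : sch.HasWeakCouplingLimit := by
    show Tendsto sch.β atTop atTop
    rw [show sch.β = fun k => β (φ k) from funext hsβ]
    exact hβ.comp hφ.tendsto_atTop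
  have hpv : ∃ N : ℕ, 1 ≤ N ∧ ∀ᶠ k in atTop, (sch.a k)⁻¹ ≤ (sch.a k * (sch.L k : ℝ)) ^ N :=
    ⟨N, hN1, hpolyN.mono fun k hk => by rw [hsa k, hsL k]; exact hk⟩
  have hpin' : ∀ k, Δ₀ * sch.a k ≤ mh (φ k) := fun k => by rw [hsa k]; exact hpin k
  have hLS' : ∀ k, S₁ (φ k) ≤ sch.L k := fun k => by rw [hsL k]; exact hLS k
  -- the lattice gap along the scheme and the RP-spectral clause
  have hGAP₀ : HasLatticeMassGap r sch Δ₀ := cclgSplit_gap_of_locked r hUNIF hsβ hpin' hLS'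
  obtain ⟨Δ, C, hΔ, hΔle, hrp⟩ := hRP sch φ Δ₀ hφ hΔ₀ hsβ hpin' hLS' hpv
  have hGAP : HasLatticeMassGap r sch Δ := cclgSplit_hasLatticeMassGap_mono r sch hΔle hGAP₀
  -- floor ∧ window at our scheme
  have hfw' := hfw sch hsa hsβ hsL
  -- the filed items U_R and W₂ at our scheme and bump, then the landed seam
  obtain ⟨sch', S₁', hw', h₁⟩ :=
    Summit.QuantumFields.YangMills.Theorems.ScalingWindowSplit.oneField_of_latticeInequalities r sch u p M Δ C
      hw hpv hΔ hGAP hrp hu hfw' (hU G r sch u p M hw hpv hu hfw') (hW₂ G r sch u p M hw hpv hu hfw')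
  -- one field ⇒ labelled witness at `G` ⇒ the Clay `G`-clause (amnesia by name, upgrade proved)
  exact concl_of_hypercubicAt hA hG (hypercubicAt_of_oneField r sch' S₁' hw' h₁)

end Core

/-- **`continuumFromLatticeGap_of_scalingWindowSplit`** — the def-free reshape-3 split of the crux stmt-QuantumFields-15915:
`XiDiverges → ⟨stub_oneScale⟩ → ⟨stub_coldPressureAtLock⟩ → SelfNormalisedMomentBoundsR → SelfNormalisedSkewness →
CurvatureAmnesia → GronwallGap.ContinuumFromLatticeGap` (reshape 4: the RP-spectral clause comes from cold pressure at
the lock through the landed `stub_rpSpectralOfColdPressure`).  One scale chooses `r`; the landed lock OFF the exceptional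
set (`stub_lockOffE`) at the crux's hypothesis and criticality from the lock (`stub_criticalOfLock`) give the locked
critical datum; then `concl_of_lockedDatum`. [cite: GlimmJaffe1987, §6.1 and §19.1] -/
theorem continuumFromLatticeGap_of_scalingWindowSplit (hXi : DirichletWindow.XiDiverges)
    (hOne : ∀ (G : Type) [Group G] [TopologicalSpace G] [IsTopologicalGroup G] [CompactSpace G]
      [MeasurableSpace G] [BorelSpace G], IsCompactSimpleLieGroup G → ∃ r : LatticeRep G,
      ∀ (β : ℕ → ℝ) (mh : ℕ → ℝ) (S₁ : ℕ → ℕ) (K : ℝ), Tendsto β atTop atTop → (∀ k, 0 < mh k) → 0 < K →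
      (∀ A B : YMSpecies G, ∃ C : ℝ, ∀ k S n : ℕ, S₁ k ≤ S → n ≤ S →
        |latticeConnectedCorr r.ρ (β k) (2 * S + 1) A.F B.F n| ≤ C * Real.exp (-(mh k * n))) →
      (∀ k S₀ : ℕ, ∃ A B : YMSpecies G, ∀ C : ℝ, ∃ S n : ℕ, S₀ ≤ S ∧ n ≤ S ∧
        C * Real.exp (-(K * mh k * n)) < |latticeConnectedCorr r.ρ (β k) (2 * S + 1) A.F B.F n|) →
      Tendsto mh atTop (𝓝 0) →
      ∃ (a : ℕ → ℝ) (φ : ℕ → ℕ) (Δ₀ : ℝ) (L : ℕ → ℕ) (u : 𝓢(EuclideanSpace ℝ (Fin 4), ℝ)) (p : ℕ) (M : ℝ),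
        (∀ k, 0 < a k) ∧ StrictMono φ ∧ 0 < Δ₀ ∧ (∀ k, Δ₀ * a k ≤ mh (φ k)) ∧ (∀ k, S₁ (φ k) ≤ L k) ∧
        (∃ N : ℕ, 1 ≤ N ∧ ∀ᶠ k in atTop, (a k)⁻¹ ≤ (a k * (L k : ℝ)) ^ N) ∧
        tsupport u ⊆ {y : EuclideanSpace ℝ (Fin 4) | y 0 < 0} ∧
        ∀ sch : SpeciesScheme (YMSpecies G), (∀ k, sch.a k = a k) → (∀ k, sch.β k = β (φ k)) →
          (∀ k, sch.L k = L k) →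
          let bare : SpeciesScheme (YMSpecies G) := { sch with c := fun _ _ => 1, m := fun _ _ => 0 }
          let T : 𝓢(EuclideanSpace ℝ (Fin 4), ℝ) → ℕ → ℝ := fun w k =>
            latticeSchwinger r.ρ bare (fun s => s.F) k (1 + 1) (fun _ => r.curvature) ![w, thetaTest 4 w] -
              latticeSchwinger r.ρ bare (fun s => s.F) k 1 (fun _ => r.curvature) ![w] *
                latticeSchwinger r.ρ bare (fun s => s.F) k 1 (fun _ => r.curvature) ![thetaTest 4 w]
          ∀ᶠ k in atTop, (sch.a k) ^ p ≤ T u k ∧ T u k ≤ M * T (timeShiftTest 4 (-1) u) k)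
    (hCP : ∀ (G : Type) [Group G] [TopologicalSpace G] [IsTopologicalGroup G] [CompactSpace G]
      [MeasurableSpace G] [BorelSpace G], IsCompactSimpleLieGroup G → ∀ (r : LatticeRep G)
      (β : ℕ → ℝ) (mh : ℕ → ℝ) (S₁ : ℕ → ℕ), Tendsto β atTop atTop → (∀ k, 0 < mh k) →
      (∀ A B : YMSpecies G, ∃ C : ℝ, ∀ k S n : ℕ, S₁ k ≤ S → n ≤ S →
        |latticeConnectedCorr r.ρ (β k) (2 * S + 1) A.F B.F n| ≤ C * Real.exp (-(mh k * n))) →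
      ∀ (sch : SpeciesScheme (YMSpecies G)) (φ : ℕ → ℕ) (Δ₀ : ℝ), StrictMono φ → 0 < Δ₀ →
        (∀ k, sch.β k = β (φ k)) → (∀ k, Δ₀ * sch.a k ≤ mh (φ k)) → (∀ k, S₁ (φ k) ≤ sch.L k) →
        (∃ N : ℕ, 1 ≤ N ∧ ∀ᶠ k in atTop, (sch.a k)⁻¹ ≤ (sch.a k * (sch.L k : ℝ)) ^ N) →
        ∃ C₀ Δ₁ : ℝ, 0 ≤ C₀ ∧ 0 < Δ₁ ∧ Δ₁ ≤ Δ₀ ∧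
          ∀ᶠ k in atTop, ∀ S : ℕ, sch.L k ≤ S → ∀ m : ℕ, S + 1 ≤ 2 * (m + 2) →
            traceExcess r.ρ (sch.β k) (2 * S + 1) (m + 2) ≤
              C₀ * ((2 * S + 1 : ℕ) : ℝ) ^ 3 * Real.exp (-(Δ₁ * sch.a k * ((m + 2 : ℕ) : ℝ))))
    (hU : ScalingWindowSplit.SelfNormalisedMomentBoundsR) (hW₂ : ScalingWindowSplit.SelfNormalisedSkewness)
    (hA : CoincidenceRotationBootstrap.CurvatureAmnesia) :
    GronwallGap.ContinuumFromLatticeGap := by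
  intro G _ _ _ _ hG hgap
  letI : MeasurableSpace G := borel G
  haveI : BorelSpace G := ⟨rfl⟩
  obtain ⟨r, hone⟩ := hOne G hG
  obtain ⟨β, mh, S₁, K, hβ, hmh, hK, hUNIF, hSHARP⟩ := stub_lockOffE hXi G hG r (hgap r)
  have hcrit : Tendsto mh atTop (𝓝 0) := stub_criticalOfLock hXi G hG r β mh S₁ hβ hmh hUNIF
  obtain ⟨a, φ, Δ₀, L, u, p, M, ha, hφ, hΔ₀, hpin, hLS, hpoly, hu, hfw⟩ :=
    hone β mh S₁ K hβ hmh hK hUNIF hSHARP hcrit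
  exact concl_of_lockedDatum hG hU hW₂ hA r β mh S₁ hβ hUNIF hcrit a φ Δ₀ L u p M ha hφ hΔ₀ hpin hLS hpoly
    hu hfw (fun sch φ' Δ₀' hφ' hΔ₀' hsβ hpin hLS hpv =>
      stub_rpSpectralOfColdPressure G hG r β mh S₁ hβ hmh hUNIF sch φ' Δ₀' hφ' hΔ₀' hsβ hpin hLS hpv
        (hCP G hG r β mh S₁ hβ hmh hUNIF sch φ' Δ₀' hφ' hΔ₀' hsβ hpin hLS hpv))

/-- **`continuumLegGivenGap_of_scalingWindowSplit`** — the SAME dock closes the sibling crux stmt-QuantumFields-15828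
`ContinuumLegGivenGap` (its hypothesis: gap at every `β ≥ β₀` with a pair-free threshold): the locked datum is the
landed `cclgSplit_locked_of_core` (17-RP lock from the RP core), criticality is again `stub_criticalOfLock` (it needs
the lock alone); then `concl_of_lockedDatum`.  Stated for route `ComplexCouplingChannel`'s copy of the shared decl.
[cite: GlimmJaffe1987, §6.1 and §19.1] -/
theorem continuumLegGivenGap_of_scalingWindowSplit (hXi : DirichletWindow.XiDiverges)
    (hOne : ∀ (G : Type) [Group G] [TopologicalSpace G] [IsTopologicalGroup G] [CompactSpace G]
      [MeasurableSpace G] [BorelSpace G], IsCompactSimpleLieGroup G → ∃ r : LatticeRep G,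
      ∀ (β : ℕ → ℝ) (mh : ℕ → ℝ) (S₁ : ℕ → ℕ) (K : ℝ), Tendsto β atTop atTop → (∀ k, 0 < mh k) → 0 < K →
      (∀ A B : YMSpecies G, ∃ C : ℝ, ∀ k S n : ℕ, S₁ k ≤ S → n ≤ S →
        |latticeConnectedCorr r.ρ (β k) (2 * S + 1) A.F B.F n| ≤ C * Real.exp (-(mh k * n))) →
      (∀ k S₀ : ℕ, ∃ A B : YMSpecies G, ∀ C : ℝ, ∃ S n : ℕ, S₀ ≤ S ∧ n ≤ S ∧
        C * Real.exp (-(K * mh k * n)) < |latticeConnectedCorr r.ρ (β k) (2 * S + 1) A.F B.F n|) →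
      Tendsto mh atTop (𝓝 0) →
      ∃ (a : ℕ → ℝ) (φ : ℕ → ℕ) (Δ₀ : ℝ) (L : ℕ → ℕ) (u : 𝓢(EuclideanSpace ℝ (Fin 4), ℝ)) (p : ℕ) (M : ℝ),
        (∀ k, 0 < a k) ∧ StrictMono φ ∧ 0 < Δ₀ ∧ (∀ k, Δ₀ * a k ≤ mh (φ k)) ∧ (∀ k, S₁ (φ k) ≤ L k) ∧
        (∃ N : ℕ, 1 ≤ N ∧ ∀ᶠ k in atTop, (a k)⁻¹ ≤ (a k * (L k : ℝ)) ^ N) ∧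
        tsupport u ⊆ {y : EuclideanSpace ℝ (Fin 4) | y 0 < 0} ∧
        ∀ sch : SpeciesScheme (YMSpecies G), (∀ k, sch.a k = a k) → (∀ k, sch.β k = β (φ k)) →
          (∀ k, sch.L k = L k) →
          let bare : SpeciesScheme (YMSpecies G) := { sch with c := fun _ _ => 1, m := fun _ _ => 0 }
          let T : 𝓢(EuclideanSpace ℝ (Fin 4), ℝ) → ℕ → ℝ := fun w k =>
            latticeSchwinger r.ρ bare (fun s => s.F) k (1 + 1) (fun _ => r.curvature) ![w, thetaTest 4 w] -
              latticeSchwinger r.ρ bare (fun s => s.F) k 1 (fun _ => r.curvature) ![w] *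
                latticeSchwinger r.ρ bare (fun s => s.F) k 1 (fun _ => r.curvature) ![thetaTest 4 w]
          ∀ᶠ k in atTop, (sch.a k) ^ p ≤ T u k ∧ T u k ≤ M * T (timeShiftTest 4 (-1) u) k)
    (hCP : ∀ (G : Type) [Group G] [TopologicalSpace G] [IsTopologicalGroup G] [CompactSpace G]
      [MeasurableSpace G] [BorelSpace G], IsCompactSimpleLieGroup G → ∀ (r : LatticeRep G)
      (β : ℕ → ℝ) (mh : ℕ → ℝ) (S₁ : ℕ → ℕ), Tendsto β atTop atTop → (∀ k, 0 < mh k) →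
      (∀ A B : YMSpecies G, ∃ C : ℝ, ∀ k S n : ℕ, S₁ k ≤ S → n ≤ S →
        |latticeConnectedCorr r.ρ (β k) (2 * S + 1) A.F B.F n| ≤ C * Real.exp (-(mh k * n))) →
      ∀ (sch : SpeciesScheme (YMSpecies G)) (φ : ℕ → ℕ) (Δ₀ : ℝ), StrictMono φ → 0 < Δ₀ →
        (∀ k, sch.β k = β (φ k)) → (∀ k, Δ₀ * sch.a k ≤ mh (φ k)) → (∀ k, S₁ (φ k) ≤ sch.L k) →
        (∃ N : ℕ, 1 ≤ N ∧ ∀ᶠ k in atTop, (sch.a k)⁻¹ ≤ (sch.a k * (sch.L k : ℝ)) ^ N) →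
        ∃ C₀ Δ₁ : ℝ, 0 ≤ C₀ ∧ 0 < Δ₁ ∧ Δ₁ ≤ Δ₀ ∧
          ∀ᶠ k in atTop, ∀ S : ℕ, sch.L k ≤ S → ∀ m : ℕ, S + 1 ≤ 2 * (m + 2) →
            traceExcess r.ρ (sch.β k) (2 * S + 1) (m + 2) ≤
              C₀ * ((2 * S + 1 : ℕ) : ℝ) ^ 3 * Real.exp (-(Δ₁ * sch.a k * ((m + 2 : ℕ) : ℝ))))
    (hU : ScalingWindowSplit.SelfNormalisedMomentBoundsR) (hW₂ : ScalingWindowSplit.SelfNormalisedSkewness)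
    (hA : CoincidenceRotationBootstrap.CurvatureAmnesia) :
    ComplexCouplingChannel.ContinuumLegGivenGap := by
  intro G _ _ _ _ hG hgap
  letI : MeasurableSpace G := borel G
  haveI : BorelSpace G := ⟨rfl⟩
  obtain ⟨r, hone⟩ := hOne G hG
  obtain ⟨β, mh, S₁, K, hβ, hmh, hK, hUNIF, hSHARP⟩ := cclgSplit_locked_of_core hXi hG r (hgap r)
  have hcrit : Tendsto mh atTop (𝓝 0) := stub_criticalOfLock hXi G hG r β mh S₁ hβ hmh hUNIF
  obtain ⟨a, φ, Δ₀, L, u, p, M, ha, hφ, hΔ₀, hpin, hLS, hpoly, hu, hfw⟩ :=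
    hone β mh S₁ K hβ hmh hK hUNIF hSHARP hcrit
  exact concl_of_lockedDatum hG hU hW₂ hA r β mh S₁ hβ hUNIF hcrit a φ Δ₀ L u p M ha hφ hΔ₀ hpin hLS hpoly
    hu hfw (fun sch φ' Δ₀' hφ' hΔ₀' hsβ hpin hLS hpv =>
      stub_rpSpectralOfColdPressure G hG r β mh S₁ hβ hmh hUNIF sch φ' Δ₀' hφ' hΔ₀' hsβ hpin hLS hpv
        (hCP G hG r β mh S₁ hβ hmh hUNIF sch φ' Δ₀' hφ' hΔ₀' hsβ hpin hLS hpv))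

/-- **The crux is implied by the four cruxes of route `ScalingWindowSplit` alone** (the "summit dock", recorded for the
planners: with W₁ `GapAtCorrelationLength` (stmt-QuantumFields-18927) taken by name as well, the crux's own hypothesis
is idle — W₁ ∧ U_R ∧ `CurvatureAmnesia` ∧ W₂ give `YangMills` by the route's deciding theorem over the landed split
`existenceLegFromLatticeR_proof` and density upgrade `euclideanUpgrade_proof`, and `YangMills` gives the crux by dropping
its hypothesis).  What the crux's hypothesis DOES pay for is isolated by `continuumFromLatticeGap_of_scalingWindowSplit`
above: W₁'s weak-coupling / polynomial-volume / lattice-gap conjuncts along one locked sequence, leaving one scale and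
cold pressure at the lock. [cite: JaffeWitten2000, §6] -/
theorem continuumFromLatticeGap_of_scalingWindowSplit_items (hW₁ : ScalingWindowSplit.GapAtCorrelationLength)
    (hU : ScalingWindowSplit.SelfNormalisedMomentBoundsR) (hA : ScalingWindowSplit.CurvatureAmnesia)
    (hW₂ : ScalingWindowSplit.SelfNormalisedSkewness) : GronwallGap.ContinuumFromLatticeGap := by
  -- buildfix 2026-08-19: `ScalingWindowSplit.closes` was re-cut over the Gapped items; the statement here keeps
  -- W₂ = `SelfNormalisedSkewness`, so `YangMills` is obtained exactly as the pre-re-cut `closes` did — the shared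
  -- deciding theorem of CoincidenceRotationBootstrap over the landed split `existenceLegFromLatticeR_proof`.
  have hYM : YangMills :=
    Summit.QuantumFields.YangMills.Theses.CoincidenceRotationBootstrap.closes hA
      (Summit.QuantumFields.YangMills.Theorems.ScalingWindowSplit.existenceLegFromLatticeR_proof hW₁ hW₂ hU)
      Summit.QuantumFields.YangMills.Theorems.ScalingWindowSplit.euclideanUpgrade_proof
  intro G _ _ _ _ hG _
  exact hYM G hG

end Summit.QuantumFields.YangMills.Theorems.ContinuumFromLatticeGap

end
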